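/- Copyright: the b2b-balaban cell (near-miss cell 7), T⁴-continuum fan-out; row NE7b ROUND-2 swarm, seat
t4-ne7b-formalise-leaf-08 (gen 13) (leaf-08's smallness-census lane F-leaf08g8-1 ∕ S12m ∕ S12q: «THE INFRARED FACTOR
DISPLAYED» = row S12r, file 2∕3 — the per-run multiplicity sockets of the window's END chain at the EXPLICIT pay threshold; INTENT
journal l.20193, owner GO R-OWNER-24-3 l.20269).  Released under the licence of the surrounding project. -/
import Summits.QuantumFields.BalabanUV.T4Continuum.Support.HistoryAssemblyTreesPayRoot
import Summits.QuantumFields.BalabanUV.T4Continuum.Support.HistoryRealiseCellsRunMultP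

/-!
# History assembly, realised per run, AT THE EXPLICIT (ROOT) PAY THRESHOLD: the multiplicity sockets at a profile level

Summits-side support leaf of the T⁴-continuum cell (rung (B)+1 on a FINITE torus only; NOT infinite volume, NOT the
mass gap, NOT the Clay statement; NOT a proof of the spine estimate NE7b).  Claim table
`t4/b2b-balaban-t4-ne7b-p1/LEAVES-NE7b.md`, leaf-08's smallness-census lane (F-leaf08g8-1 ∕ rows S12m, S12q): row S12r
«THE INFRARED FACTOR DISPLAYED» (owner GO R-OWNER-24-3, journal l.20269), file 2∕3 (file 1∕3 =
`HistoryAssemblyTreesPayRoot`, whose module docstring carries the WHY: the tree's only window theorem p232166 displays a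
first factor `e^{−irThresholdTLE∕2}` over the NAMED, sizeless `Classical.choose` threshold, while the census of record
(11q) sizes it on leaf-08 gen 8's EXPLICIT root road `HistoryPayThresholdRoot.payThresholdRoot` (p225123), on which no
END ran).

WHAT.  The two per-run multiplicity sockets of row S12j, re-plugged at the explicit threshold — each the tree's theorem
VERBATIM with the ONE binder `hir : irThresholdTLE C F.L rr β₀ ≤ log (g²)⁻¹` re-lettered to
`payThresholdRoot C F.L rr β₀` and its callee swapped (token diff: name, `hir`, callee — nothing else):
§1 **`hybridNE7_of_realisedRun_printedMultPPayRoot`** = `HistoryAssemblyRealiseRunMultP.hybridNE7_of_realisedRun_printedMultP`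
(p223263) over file 1's `hybridNE7_of_termReadingLE_multPayRoot`;
§2 **`hybridNE7_of_realisedDomainsRun_printedMultPPayRoot`** = `HistoryRealiseCellsRunMultP.hybridNE7_of_realisedDomainsRun_printedMultP`
(p223419) over §1.

HONEST READING (c4).  Re-plumbing of OUR ENDs over OUR explicit threshold; the sockets of record on the named threshold
(p223263, p223419) and everything downstream of them (END v3.1′ p223694, pinned p224056, headline p224237, window
p232166) are UNCHANGED BY NAME and not superseded (the two thresholds are incomparable in the kernel).  [folklore]
composition by name; no `def`, no `structure`, no `Prop`-fact minted (c1), no `[cite:]` tag, nothing printed asserted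
(ABSOLUTE RULE), constants symbolic (c2∕c6), no exit ∕ socket ∕ `HistoryConstants*` ∕ landed file touched (c3).
Displayed as in the originals: constants, flow (⇐ BetaPertHyp), tuning, the profile level `hP`, the (2.5) side
condition, (B) side, H3 (realised pedigrees ∕ domains, realised costs, the price sentences with the discount `Ξ`,
the slot multiplicity `hmult`, numerator readings), the seam data (NE7c's `ShellWeightBound`, NE7's `ReindexedBudget`,
four summable rates).  NE7b NOT proved; spine PROVED 0∕9.  HONEST DEPENDENCY (cell): continuum YM on T⁴ ⇐ BetaPertH ∧
nine spine estimates (0/9 proved); BetaPertH ⇐ (D1) ∧ (D4) ∧ CAP+tail; G-an2-4 gates asym, D1 and NE2/3/4.  This file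
changes none of it. -/

open Finset MeasureTheory
open Literature.MathematicalPhysics.QuantumFieldTheory.Balaban1983to89
open T4PersistenceDictionary T4PersistentHistoryCount T4BankedInduction T4PrintedShapeBanking
open T4WeightBudget T4GlobalDenominator T4LiveClassFibration T4LiveStructureGas T4LiveGasToTerms T4RecordPriceSeam
open T4PartnerMultiplicity T4IndicatorShell T4MatchingAssembly T4MatchingClosure T4MatchingClosureSocket T4Continuum
open T4StabilitySocket T4BranchingRecordsGas T4TaggedShapeBanking T4CanonicalMenus T4RenewalChains
open Summit.QuantumFields.BalabanUV.T4Continuum.PlacementBatch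
open Summit.QuantumFields.BalabanUV.T4Continuum.PlacementSkeleton
open Summit.QuantumFields.BalabanUV.T4Continuum.CountThresholdUniform
open Summit.QuantumFields.BalabanUV.T4Continuum.CountThresholdExit
open Summit.QuantumFields.BalabanUV.T4Continuum.CountSeamJunction
open Summit.QuantumFields.BalabanUV.T4Continuum.LateMergers
open Summit.QuantumFields.BalabanUV.T4Continuum.HistoryFlow
open Summit.QuantumFields.BalabanUV.T4Continuum.HistoryRegeneration
open Summit.QuantumFields.BalabanUV.T4Continuum.HistoryTables
open Summit.QuantumFields.BalabanUV.T4Continuum.HistoryAssemblyTrees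
open Summit.QuantumFields.BalabanUV.T4Continuum.HistoryAssemblyTerms
open Summit.QuantumFields.BalabanUV.T4Continuum.HistoryAssemblyPedigree
open Summit.QuantumFields.BalabanUV.T4Continuum.HistoryConstants
open Summit.QuantumFields.BalabanUV.T4Continuum.HistoryGen
open Literature.MathematicalPhysics.QuantumFieldTheory.Balaban1983to89.B13ScaleTransfer
open Summit.QuantumFields.BalabanUV.T4Continuum.ZoneSkeleton
open Summit.QuantumFields.BalabanUV.T4Continuum.HistorySocketTH
open Summit.QuantumFields.BalabanUV.T4Continuum.HistoryCaps
open Summit.QuantumFields.BalabanUV.T4Continuum.HistoryAssemblyPrice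
open Summit.QuantumFields.BalabanUV.T4Continuum.HistoryBankingLE
open Summit.QuantumFields.BalabanUV.T4Continuum.HistoryExitLE
open Summit.QuantumFields.BalabanUV.T4Continuum.HistoryAssemblyTreesLE
open Summit.QuantumFields.BalabanUV.T4Continuum.HistoryAssemblyTermsLE
open Summit.QuantumFields.BalabanUV.T4Continuum.HistoryRealise
open Summit.QuantumFields.BalabanUV.T4Continuum.HistoryAssemblyRealiseLE
open Summit.QuantumFields.BalabanUV.T4Continuum.HistoryAssemblyMult
open Summit.QuantumFields.BalabanUV.T4Continuum.HistoryAssemblyMultKey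
open Summit.QuantumFields.BalabanUV.T4Continuum.HistoryAssemblyRealiseRun
open Summit.QuantumFields.BalabanUV.T4Continuum.HistoryAssemblyRealiseMult
open Summit.QuantumFields.BalabanUV.T4Continuum.HistoryAssemblyMultProfile
open Summit.QuantumFields.BalabanUV.T4Continuum.HistoryZones
open Summit.QuantumFields.BalabanUV.T4Continuum.HistoryRealiseCells
open Summit.QuantumFields.BalabanUV.T4Continuum.HistoryRealiseCellsRun
open Summit.QuantumFields.BalabanUV.T4Continuum.HistoryAssemblyRealiseRunMultP
open Summit.QuantumFields.BalabanUV.T4Continuum.HistoryPayThresholdRoot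
open Summit.QuantumFields.BalabanUV.T4Continuum.HistoryAssemblyTreesPayRoot

namespace Summit.QuantumFields.BalabanUV.T4Continuum.HistoryAssemblyRealiseRunMultPPayRoot

noncomputable section

/-! ## §1 The per-run END with the slot multiplicity displayed at a profile level, explicit threshold -/

section Run

variable {F : T4Family} {G : Type*} [GaugeGroup G] [MeasurableSpace G] [HaarData G] [RegularGaugeGroup G]
variable {α π δ : Type*} [DecidableEq α] [DecidableEq π] [DecidableEq δ] {dP : ℕ}
variable {ι : Type*} [DecidableEq ι] {l₀ vol : ℝ} {K₀ : ℕ} {T : ℕ → Finset ι} {A A' shA shB : ℕ → ℝ → ι → ℝ}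
  {dead dead' : ℕ → ℝ → ι → ℝ} {nup mup : ℕ → ℝ → ℝ} {Nup : ℝ}
  {Cc Rr CcRec RrRec : ℕ → ℝ → ι → ℝ} {ν u s₂ q₀ r s Wsh : ℕ → ℝ}

/-- **NE7b's COUNT EXIT, PER RUN, WITH THE SLOT MULTIPLICITY DISPLAYED AT A PROFILE LEVEL `P`, AT THE EXPLICIT (ROOT)
PAY THRESHOLD.**  `HistoryAssemblyRealiseRunMultP.hybridNE7_of_realisedRun_printedMultP` (p223263) VERBATIM with the single
binder `hir` re-lettered `irThresholdTLE ↦ HistoryPayThresholdRoot.payThresholdRoot`; proof = the same composition over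
`HistoryAssemblyTreesPayRoot.hybridNE7_of_termReadingLE_multPayRoot`.  Conclusion and every other binder byte-identical.
NE7b NOT proved. [folklore] -/
theorem hybridNE7_of_realisedRun_printedMultPPayRoot (D : FiniteEpsData F G) {C : T4PrintedShapeBanking.Consts}
    {O : PrintedO1s}
    {rr : ℕ} {β₀ : ℝ} (h : ThresholdOK C F.L rr β₀) (hμ : 0 < C.μ) (d n : ℕ)
    (hκ₁ : (d : ℝ) * Real.log F.L + 2 * Real.log 2 ≤ C.κ₁) (hE₀ : Real.log (2 + birthMass C) ≤ C.E₀)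
    -- the flow side (⇐ BetaPertH, displayed) and tuning
    {γ₀ γb b β' : ℝ} {pe : ℕ} (hb : 0 ≤ b) (hlo : FlowStep.BetaLowerH b γ₀ D.βfun)
    (hhi : FlowStep.BetaUpperH β' γ₀ D.βfun) (hγ : γb ≤ γ₀) (hγβ : γb ^ 2 * β' < 1)
    (S : B14FlowStep.SmallnessFor γb β' β₀ F.L pe) (hp₀ : C.p₀ ≤ pe) (hrr : rr ≤ pe) (hβ : β₀ ≤ 1 / 2)
    {g : ℝ} {g₀ : ℕ → ℝ} (ht : D.Tuned γb g g₀)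
    (hir : payThresholdRoot C F.L rr β₀ ≤ Real.log (g ^ 2)⁻¹)
    -- row S12j: a displayed profile LEVEL `P ≥ 1` below `p₀(g_K(s))` along every run (in the pinned ∕ apex form it is
    -- DISCHARGED from the infrared threshold: `p₀` at the threshold) — the class-linear slack is read AT THIS LEVEL
    {P : ℝ} (hP1 : 1 ≤ P)
    (hP : ∀ K, K₀ ≤ K → ∀ s, s ≤ K → P ≤ p0Profile C.A₀ C.p₀ ((D.C ⟨K, F.m, g₀ K⟩).flow.g s))
    -- the (B) side
    (hsign : B16.SignConventions D.C) {γB : ℝ} {em ep : ℝ → ℝ} (hcor : B16.Cor3With D.C γB em ep) (hγB : γb ≤ γB)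
    {obs : (K : ℕ) → GaugeField (F.P K) 0 G → ℝ} {B : ℝ}
    (hobs : ∀ K, Measurable (obs K)) (hbd : ∀ K U, |obs K U| ≤ B)
    (hα : ∀ K t, |t| ≤ l₀ → K₀ ≤ K →
      ∫ U, Real.exp (t * obs K U) * D.dens K (g₀ K) 0 U ∂fieldMeasure (F.P K) 0 G ≤ ∑ τ ∈ T K, A K t τ)
    (hα' : ∀ K t, |t| ≤ l₀ → K₀ ≤ K →
      ∫ U, Real.exp (t * obs (K + 1) U) * D.dens (K + 1) (g₀ (K + 1)) 0 U ∂fieldMeasure (F.P (K + 1)) 0 G ≤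
        ∑ τ ∈ T K, A' K t τ)
    {c₀ n₁ : ℝ} (hc₀ : 0 < c₀) (hfloor : ∀ K, K₀ ≤ K → c₀ ≤ smallFieldMass D K (g₀ K))
    (hfloor' : ∀ K, K₀ ≤ K → c₀ ≤ smallFieldMass D (K + 1) (g₀ (K + 1)))
    (hsites : ∀ K, K₀ ≤ K → ((D.C ⟨K, F.m, g₀ K⟩).numSites K : ℝ) ≤ n₁)
    (hsites' : ∀ K, K₀ ≤ K → ((D.C ⟨K + 1, F.m, g₀ (K + 1)⟩).numSites (K + 1) : ℝ) ≤ n₁)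
    (hNup : 0 ≤ Nup) (hnup : ∀ K t, |t| ≤ l₀ → K₀ ≤ K → 0 ≤ nup K t ∧ nup K t ≤ Nup)
    (hmup : ∀ K t, |t| ≤ l₀ → K₀ ≤ K → 0 ≤ mup K t ∧ mup K t ≤ Nup)
    -- the (2.5) side condition on the size function
    (R : ℕ → ℕ → ℕ) (hR : ∀ K s, s ≤ K → B14.IsRj F.L rr ((D.C ⟨K, F.m, g₀ K⟩).flow.g s) (R K s))
    -- the side conditions of the geometric lemmas (row S1b): torus side, window constant, sizes (NO drop control)
    (hL4 : 4 ≤ F.L) (hn₁ : 13 ≤ C.n₁) (hR1 : ∀ K, K₀ ≤ K → ∀ t, 1 ≤ R K t)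
    -- H3: the terms read as pedigrees REALISED BY THE RUN'S OWN PROFILE, pending, with root cells
    (ped : ℕ → ι → Pedigree α π) (cellP : ℕ → ι → π → Pt dP × Finset (Pt dP)) (liveC : ℕ → ι → Finset α)
    (cellOf : ℕ → ι → α → (Fin d → ℕ))
    (H : RealisedReadingR F.L (runProfile F.L R) (cellN d n F.L) K₀ R T ped cellP liveC cellOf)
    -- the PHYSICAL READING of the live components (the consumer's datum: which components of different terms are the same)
    (phys : ℕ → ι → α → δ)
    -- the class-linear slack: `C.a + θ ≤ ½γ₀A₁²` (ANY positive slack) pays `e^{θ·P·birthLinT}` at the level `P`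
    {θ : ℝ} (hθ : 0 ≤ θ) (hslack : C.a + θ ≤ O.γ₀ * O.A₁ ^ 2 / 2)
    -- the partner letters: `Λm` for the slot multiplicity, `Λr` left in H3's printed price, `Λm·Λr ≤ L^d`
    {Λm Λr : ℝ} (hΛm : 0 ≤ Λm) (hΛr : 0 ≤ Λr) (hΛmr : Λm * Λr ≤ (F.L : ℝ) ^ d)
    -- H3: realised per-step costs of the live members, read below the model's booked cost (reading (ID-a))
    (κ κ' : ℕ → (Fin d → ℕ) × Gen (Lab α π) → Gen (Lab α π) → ℕ → ℝ)
    (hκ : ∀ K, K₀ ≤ K → ∀ τ ∈ badTerms (memOf ped liveC cellOf) jhalf T K, ∀ q ∈ memOf ped liveC cellOf K τ,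
      ∀ m ∈ life (padW (dictWT Prod.fst (R K) C.n₁) 0) q.2,
        κ K q q.2 m ≤ costT Prod.fst C K (R K) q.2 m)
    (hκ' : ∀ K, K₀ ≤ K → ∀ τ ∈ badTerms (memOf ped liveC cellOf) jhalf T K, ∀ q ∈ memOf ped liveC cellOf K τ,
      ∀ m ∈ life (padW (dictWT Prod.fst (R K) C.n₁) 0) q.2,
        κ' K q q.2 m ≤ costT Prod.fst C K (R K) q.2 m)
    -- row S6g′'s INSTANCE: the renewal-entropy allowance `Ξ` and THE SLOT MULTIPLICITY OF THE PHYSICAL MEMBERS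
    (Ξ : ℕ → (Fin d → ℕ) × Gen (Lab α π) → ℝ)
    (hmult : ∀ K, K₀ ≤ K → ∀ τ ∈ badTerms (memOf ped liveC cellOf) jhalf T K, ∀ c ∈ liveC K τ,
      ((koccOf ped liveC cellOf phys jhalf T K (kslot (keyOf ped cellOf phys K τ c))).card : ℝ) ≤
        Real.exp (θ * P * birthLinT Prod.fst ((ped K τ).genT c) + Ξ K (cellOf K τ c, (ped K τ).genT c)) *
          Λm ^ partnerAges (PEv.step ∘ Prod.fst) ((ped K τ).genT c))
    -- H3: the per-term price sentence over the named members in PRINT's currency, discounted by the allowance; the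
    -- live price of the PHYSICAL member family; both runs
    {FcM RfM FcM' RfM' : ℕ → Finset ((Fin d → ℕ) × Gen PEv × δ) → ℝ}
    (hPM : ∀ K t, |t| ≤ l₀ → K₀ ≤ K → ∀ τ ∈ badTerms (memOf ped liveC cellOf) jhalf T K,
      FcM K (kmemOf ped liveC cellOf phys K τ) * RfM K (kmemOf ped liveC cellOf phys K τ) ≤
        ∏ q ∈ memOf ped liveC cellOf K τ,
          pshapeTH Prod.fst O C 1 Λr (R K) (D.C ⟨K, F.m, g₀ K⟩).flow.g 0 (κ K q) q.2 * Real.exp (-Ξ K q))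
    (hPM' : ∀ K t, |t| ≤ l₀ → K₀ ≤ K → ∀ τ ∈ badTerms (memOf ped liveC cellOf) jhalf T K,
      FcM' K (kmemOf ped liveC cellOf phys K τ) * RfM' K (kmemOf ped liveC cellOf phys K τ) ≤
        ∏ q ∈ memOf ped liveC cellOf K τ,
          pshapeTH Prod.fst O C 1 Λr (R K) (D.C ⟨K, F.m, g₀ K⟩).flow.g 0 (κ' K q) q.2 * Real.exp (-Ξ K q))
    -- H3: the remaining `Regeneration` numerator readings, over the PHYSICAL member families of the bad terms
    (upM : ∀ K t, |t| ≤ l₀ → K₀ ≤ K →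
      ∀ k ∈ badGMems (memOf ped liveC cellOf) jhalf T (kmemOf ped liveC cellOf phys) K,
        ∀ τ ∈ fibre (kmemOf ped liveC cellOf phys) T K k, A K t τ ≤ dead K t τ * FcM K k * nup K t)
    (deadM_nonneg : ∀ K t, |t| ≤ l₀ → K₀ ≤ K →
      ∀ k ∈ badGMems (memOf ped liveC cellOf) jhalf T (kmemOf ped liveC cellOf phys) K,
        ∀ τ ∈ fibre (kmemOf ped liveC cellOf phys) T K k, 0 ≤ dead K t τ)
    (resumM : ∀ K t, |t| ≤ l₀ → K₀ ≤ K →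
      ∀ k ∈ badGMems (memOf ped liveC cellOf) jhalf T (kmemOf ped liveC cellOf phys) K,
        ∑ τ ∈ fibre (kmemOf ped liveC cellOf phys) T K k, dead K t τ ≤ RfM K k)
    (FM_nonneg : ∀ K t, |t| ≤ l₀ → K₀ ≤ K →
      ∀ k ∈ badGMems (memOf ped liveC cellOf) jhalf T (kmemOf ped liveC cellOf phys) K, 0 ≤ FcM K k)
    (upM' : ∀ K t, |t| ≤ l₀ → K₀ ≤ K →
      ∀ k ∈ badGMems (memOf ped liveC cellOf) jhalf T (kmemOf ped liveC cellOf phys) K,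
        ∀ τ ∈ fibre (kmemOf ped liveC cellOf phys) T K k, A' K t τ ≤ dead' K t τ * FcM' K k * mup K t)
    (deadM'_nonneg : ∀ K t, |t| ≤ l₀ → K₀ ≤ K →
      ∀ k ∈ badGMems (memOf ped liveC cellOf) jhalf T (kmemOf ped liveC cellOf phys) K,
        ∀ τ ∈ fibre (kmemOf ped liveC cellOf phys) T K k, 0 ≤ dead' K t τ)
    (resumM' : ∀ K t, |t| ≤ l₀ → K₀ ≤ K →
      ∀ k ∈ badGMems (memOf ped liveC cellOf) jhalf T (kmemOf ped liveC cellOf phys) K,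
        ∑ τ ∈ fibre (kmemOf ped liveC cellOf phys) T K k, dead' K t τ ≤ RfM' K k)
    (FM'_nonneg : ∀ K t, |t| ≤ l₀ → K₀ ≤ K →
      ∀ k ∈ badGMems (memOf ped liveC cellOf) jhalf T (kmemOf ped liveC cellOf phys) K, 0 ≤ FcM' K k)
    -- the seam's other inputs
    (hSh : ShellWeightBound l₀ T A A' shA shB Wsh)
    (hTB : ReindexedBudget l₀ vol T (fun K t τ => A K t τ - shA K t τ) (fun K t τ => A' K t τ - shB K t τ)
      (badOfClass (bstrOf Prod.fst (memOf ped liveC cellOf)) T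
        (fun K _ => badClasses Prod.fst (memOf ped liveC cellOf) jhalf T K)) Cc Rr CcRec RrRec ν u s₂ q₀ r s)
    (hr : Summable r) (hu : Summable u) (hs : Summable s) (hs₂ : Summable s₂) :
    ∃ K₁ K₂, K₀ ≤ K₁ ∧ HybridNE7 l₀ vol (fun K => T (K₁ + (K₂ + K))) (fun K => A (K₁ + (K₂ + K)))
      (fun K => A' (K₁ + (K₂ + K)))
      (fun K => badOfClass (bstrOf Prod.fst (memOf ped liveC cellOf)) T
        (fun K _ => badClasses Prod.fst (memOf ped liveC cellOf) jhalf T K) (K₁ + (K₂ + K)))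
      (fun K => constOf l₀ B (max (em g) 0) n₁ c₀ Nup *
        recordsBudget (birthMass C) C.κ₁ ((n : ℝ) ^ d) ((F.L : ℝ) ^ d) (Real.log 2) jhalf (K₁ + (K₂ + K)))
      (fun K => shA (K₁ + (K₂ + K))) (fun K => shB (K₁ + (K₂ + K))) (fun K => Wsh (K₁ + (K₂ + K)))
      (fun K => (r (K₁ + (K₂ + K)) + u (K₁ + (K₂ + K))) + (s (K₁ + (K₂ + K)) + s₂ (K₁ + (K₂ + K)))) := by
  -- the profile level at the members' birth steps: `ConsistentTLE.step_le` + the displayed `hP`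
  have HT := termReadingLE_of_realisedR (C := C) hL4
    (fun K _ => dropCtl_runProfile D hb hlo hhi hγ hγβ S hrr hβ ht R hR K) hn₁ hR1 H jhalf
  have hPK : ∀ K, K₀ ≤ K → ∀ τ ∈ badTerms (memOf ped liveC cellOf) jhalf T K, ∀ q ∈ memOf ped liveC cellOf K τ,
      ∀ e ∈ q.2.events, (Prod.fst e).kind = 0 →
        P ≤ p0Profile C.A₀ C.p₀ ((D.C ⟨K, F.m, g₀ K⟩).flow.g (Prod.fst e).step) :=
    fun K hK τ hτ q hq e he _ => hP K hK _ ((HT.consistent K hK τ hτ q hq).step_le e he)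
  -- the per-occupant bound from the slot multiplicity, for a cost reading `κ₀`
  have hoccOf : ∀ κ₀ : ℕ → (Fin d → ℕ) × Gen (Lab α π) → Gen (Lab α π) → ℕ → ℝ,
      (∀ K, K₀ ≤ K → ∀ τ ∈ badTerms (memOf ped liveC cellOf) jhalf T K, ∀ q ∈ memOf ped liveC cellOf K τ,
        ∀ m ∈ life (padW (dictWT Prod.fst (R K) C.n₁) 0) q.2, κ₀ K q q.2 m ≤ costT Prod.fst C K (R K) q.2 m) →
      ∀ K, K₀ ≤ K → ∀ s, ∀ w ∈ koccOf ped liveC cellOf phys jhalf T K s,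
        ((koccOf ped liveC cellOf phys jhalf T K s).card : ℝ) *
            supPriceK ped liveC cellOf phys jhalf T
              (fun K q => pshapeTH Prod.fst O C 1 Λr (R K) (D.C ⟨K, F.m, g₀ K⟩).flow.g 0 (κ₀ K q) q.2 *
                Real.exp (-Ξ K q)) K w ≤
          bslotPrice (yT Prod.fst C ((F.L : ℝ) ^ d) R (fun K => (D.C ⟨K, F.m, g₀ K⟩).flow.g)
            (memOf ped liveC cellOf) jhalf T K) s := by
    intro κ₀ hκ₀ K hK
    refine hocc_of_boundK fun τ hτ c hc => ?_
    have hq : (cellOf K τ c, (ped K τ).genT c) ∈ memOf ped liveC cellOf K τ := mem_memOf.2 ⟨c, hc, rfl⟩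
    exact card_mul_pshapeTH_le_priceT_of_profile Prod.fst hθ hslack hP1 hΛm hΛr hΛmr R
      (fun K => (D.C ⟨K, F.m, g₀ K⟩).flow.g) K (hPK K hK τ hτ _ hq) (hκ₀ K hK τ hτ _ hq) (hmult K hK τ hτ c hc)
  have hpr : ∀ (κ₀ : ℕ → (Fin d → ℕ) × Gen (Lab α π) → Gen (Lab α π) → ℕ → ℝ) (K : ℕ)
      (q : (Fin d → ℕ) × Gen (Lab α π)),
      0 ≤ pshapeTH Prod.fst O C 1 Λr (R K) (D.C ⟨K, F.m, g₀ K⟩).flow.g 0 (κ₀ K q) q.2 * Real.exp (-Ξ K q) :=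
    fun κ₀ K q => mul_nonneg (pshapeTH_nonneg Prod.fst zero_le_one hΛr _ _ _ _ _) (Real.exp_pos _).le
  exact hybridNE7_of_termReadingLE_multPayRoot D Prod.fst h hμ d n (dcapOf Prod.fst T (memOf ped liveC cellOf))
    (ncapOf T (memOf ped liveC cellOf)) hκ₁ hE₀ hb hlo hhi hγ hγβ S hp₀ hrr ht hir hsign hcor hγB hobs hbd hα hα' hc₀
    hfloor hfloor' hsites hsites' hNup hnup hmup R hR (memOf ped liveC cellOf) HT
    (kmemOf ped liveC cellOf phys) kslot
    (fun K hK τ hτ => image_kslot_kmemOf)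
    (fun K hK τ hτ => injOn_kslot_kmemOf (H.cell_inj K hK τ (mem_badTerms.1 hτ).1))
    (supPriceK ped liveC cellOf phys jhalf T fun K q =>
      pshapeTH Prod.fst O C 1 Λr (R K) (D.C ⟨K, F.m, g₀ K⟩).flow.g 0 (κ K q) q.2 * Real.exp (-Ξ K q))
    (supPriceK ped liveC cellOf phys jhalf T fun K q =>
      pshapeTH Prod.fst O C 1 Λr (R K) (D.C ⟨K, F.m, g₀ K⟩).flow.g 0 (κ' K q) q.2 * Real.exp (-Ξ K q))
    (fun K w => supPriceK_nonneg (hpr κ K) w) (fun K w => supPriceK_nonneg (hpr κ' K) w)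
    (hoccOf κ hκ) (hoccOf κ' hκ')
    (fun K t ht hK τ hτ => (hPM K t ht hK τ hτ).trans
      (prod_memOf_le_prod_supPriceK (phys := phys)
        (pr := fun K q => pshapeTH Prod.fst O C 1 Λr (R K) (D.C ⟨K, F.m, g₀ K⟩).flow.g 0 (κ K q) q.2 *
          Real.exp (-Ξ K q)) (hpr κ K) hτ (H.cell_inj K hK τ (mem_badTerms.1 hτ).1)))
    (fun K t ht hK τ hτ => (hPM' K t ht hK τ hτ).trans
      (prod_memOf_le_prod_supPriceK (phys := phys)
        (pr := fun K q => pshapeTH Prod.fst O C 1 Λr (R K) (D.C ⟨K, F.m, g₀ K⟩).flow.g 0 (κ' K q) q.2 *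
          Real.exp (-Ξ K q)) (hpr κ' K) hτ (H.cell_inj K hK τ (mem_badTerms.1 hτ).1)))
    upM deadM_nonneg resumM FM_nonneg upM' deadM'_nonneg resumM' FM'_nonneg hSh hTB hr hu hs hs₂

end Run

/-! ## §2 The END of record v2's twin with the slot multiplicity displayed at a profile level, explicit threshold -/

section Cells

variable {F : T4Family} {G : Type*} [GaugeGroup G] [MeasurableSpace G] [HaarData G] [RegularGaugeGroup G]
variable {α π δ : Type*} [DecidableEq α] [DecidableEq π] [DecidableEq δ]
variable {ι : Type*} [DecidableEq ι] {l₀ vol : ℝ} {K₀ : ℕ} {T : ℕ → Finset ι} {A A' shA shB : ℕ → ℝ → ι → ℝ}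
  {dead dead' : ℕ → ℝ → ι → ℝ} {nup mup : ℕ → ℝ → ℝ} {Nup : ℝ}
  {Cc Rr CcRec RrRec : ℕ → ℝ → ι → ℝ} {ν u s₂ q₀ r s Wsh : ℕ → ℝ}

/-- **NE7b's COUNT EXIT — THE END OF RECORD v2's TWIN WITH THE SLOT MULTIPLICITY DISPLAYED AT A PROFILE LEVEL `P`,
AT THE EXPLICIT (ROOT) PAY THRESHOLD.**  `HistoryRealiseCellsRunMultP.hybridNE7_of_realisedDomainsRun_printedMultP` (p223419)
VERBATIM with the single binder `hir` re-lettered `irThresholdTLE ↦ HistoryPayThresholdRoot.payThresholdRoot`; proof =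
the same three-line composition over §1.  Conclusion and every other binder byte-identical.  NE7b NOT proved.
[folklore] -/
theorem hybridNE7_of_realisedDomainsRun_printedMultPPayRoot (D : FiniteEpsData F G) {C : T4PrintedShapeBanking.Consts}
    {O : PrintedO1s}
    {rr : ℕ} {β₀ : ℝ} (h : ThresholdOK C F.L rr β₀) (hμ : 0 < C.μ) (d n : ℕ)
    (hκ₁ : (d : ℝ) * Real.log F.L + 2 * Real.log 2 ≤ C.κ₁) (hE₀ : Real.log (2 + birthMass C) ≤ C.E₀)
    -- the flow side (⇐ BetaPertH, displayed) and tuning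
    {γ₀ γb b β' : ℝ} {pe : ℕ} (hb : 0 ≤ b) (hlo : FlowStep.BetaLowerH b γ₀ D.βfun)
    (hhi : FlowStep.BetaUpperH β' γ₀ D.βfun) (hγ : γb ≤ γ₀) (hγβ : γb ^ 2 * β' < 1)
    (S : B14FlowStep.SmallnessFor γb β' β₀ F.L pe) (hp₀ : C.p₀ ≤ pe) (hrr : rr ≤ pe) (hβ : β₀ ≤ 1 / 2)
    {g : ℝ} {g₀ : ℕ → ℝ} (ht : D.Tuned γb g g₀)
    (hir : payThresholdRoot C F.L rr β₀ ≤ Real.log (g ^ 2)⁻¹)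
    -- row S12j: a displayed profile LEVEL `P ≥ 1` below `p₀(g_K(s))` along every run (in the pinned ∕ apex form it is
    -- DISCHARGED from the infrared threshold: `p₀` at the threshold) — the class-linear slack is read AT THIS LEVEL
    {P : ℝ} (hP1 : 1 ≤ P)
    (hP : ∀ K, K₀ ≤ K → ∀ s, s ≤ K → P ≤ p0Profile C.A₀ C.p₀ ((D.C ⟨K, F.m, g₀ K⟩).flow.g s))
    -- the (B) side
    (hsign : B16.SignConventions D.C) {γB : ℝ} {em ep : ℝ → ℝ} (hcor : B16.Cor3With D.C γB em ep) (hγB : γb ≤ γB)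
    {obs : (K : ℕ) → GaugeField (F.P K) 0 G → ℝ} {B : ℝ}
    (hobs : ∀ K, Measurable (obs K)) (hbd : ∀ K U, |obs K U| ≤ B)
    (hα : ∀ K t, |t| ≤ l₀ → K₀ ≤ K →
      ∫ U, Real.exp (t * obs K U) * D.dens K (g₀ K) 0 U ∂fieldMeasure (F.P K) 0 G ≤ ∑ τ ∈ T K, A K t τ)
    (hα' : ∀ K t, |t| ≤ l₀ → K₀ ≤ K →
      ∫ U, Real.exp (t * obs (K + 1) U) * D.dens (K + 1) (g₀ (K + 1)) 0 U ∂fieldMeasure (F.P (K + 1)) 0 G ≤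
        ∑ τ ∈ T K, A' K t τ)
    {c₀ n₁ : ℝ} (hc₀ : 0 < c₀) (hfloor : ∀ K, K₀ ≤ K → c₀ ≤ smallFieldMass D K (g₀ K))
    (hfloor' : ∀ K, K₀ ≤ K → c₀ ≤ smallFieldMass D (K + 1) (g₀ (K + 1)))
    (hsites : ∀ K, K₀ ≤ K → ((D.C ⟨K, F.m, g₀ K⟩).numSites K : ℝ) ≤ n₁)
    (hsites' : ∀ K, K₀ ≤ K → ((D.C ⟨K + 1, F.m, g₀ (K + 1)⟩).numSites (K + 1) : ℝ) ≤ n₁)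
    (hNup : 0 ≤ Nup) (hnup : ∀ K t, |t| ≤ l₀ → K₀ ≤ K → 0 ≤ nup K t ∧ nup K t ≤ Nup)
    (hmup : ∀ K t, |t| ≤ l₀ → K₀ ≤ K → 0 ≤ mup K t ∧ mup K t ≤ Nup)
    -- the (2.5) side condition on the size function
    (R : ℕ → ℕ → ℕ) (hR : ∀ K s, s ≤ K → B14.IsRj F.L rr ((D.C ⟨K, F.m, g₀ K⟩).flow.g s) (R K s))
    -- the side conditions of the geometric lemmas (row S1b): torus side, window constant, sizes (NO drop control)
    (hL4 : 4 ≤ F.L) (hn₁ : 13 ≤ C.n₁) (hR1 : ∀ K, K₀ ≤ K → ∀ t, 1 ≤ R K t)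
    -- H3: the terms read as pedigrees REALISED BY THE RUN'S OWN PROFILE with their DOMAINS (root cells := `cellOfR`)
    (ped : ℕ → ι → Pedigree α π) (cellP : ℕ → ι → π → Pt d × Finset (Pt d)) (liveC : ℕ → ι → Finset α)
    (Zd : ℕ → ι → α → Finset (Pt d)) (H : RealisedDomainsR F.L (runProfile F.L R) n K₀ R T ped cellP liveC Zd)
    (hn : 0 < n)
    -- the PHYSICAL READING of the live components (the consumer's datum: which components of different terms are the same)
    (phys : ℕ → ι → α → δ)
    -- the class-linear slack: `C.a + θ ≤ ½γ₀A₁²` (ANY positive slack) pays `e^{θ·P·birthLinT}` at the level `P`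
    {θ : ℝ} (hθ : 0 ≤ θ) (hslack : C.a + θ ≤ O.γ₀ * O.A₁ ^ 2 / 2)
    -- the partner letters: `Λm` for the slot multiplicity, `Λr` left in H3's printed price, `Λm·Λr ≤ L^d`
    {Λm Λr : ℝ} (hΛm : 0 ≤ Λm) (hΛr : 0 ≤ Λr) (hΛmr : Λm * Λr ≤ (F.L : ℝ) ^ d)
    -- H3: realised per-step costs of the live members, read below the model's booked cost (reading (ID-a))
    (κ κ' : ℕ → (Fin d → ℕ) × Gen (Lab α π) → Gen (Lab α π) → ℕ → ℝ)
    (hκ : ∀ K, K₀ ≤ K → ∀ τ ∈ badTerms (memOf ped liveC (cellOfR n F.L (runProfile F.L R) ped cellP)) jhalf T K, ∀ q ∈ memOf ped liveC (cellOfR n F.L (runProfile F.L R) ped cellP) K τ,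
      ∀ m ∈ life (padW (dictWT Prod.fst (R K) C.n₁) 0) q.2,
        κ K q q.2 m ≤ costT Prod.fst C K (R K) q.2 m)
    (hκ' : ∀ K, K₀ ≤ K → ∀ τ ∈ badTerms (memOf ped liveC (cellOfR n F.L (runProfile F.L R) ped cellP)) jhalf T K, ∀ q ∈ memOf ped liveC (cellOfR n F.L (runProfile F.L R) ped cellP) K τ,
      ∀ m ∈ life (padW (dictWT Prod.fst (R K) C.n₁) 0) q.2,
        κ' K q q.2 m ≤ costT Prod.fst C K (R K) q.2 m)
    -- row S6g′'s INSTANCE: the renewal-entropy allowance `Ξ` and THE SLOT MULTIPLICITY OF THE PHYSICAL MEMBERS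
    (Ξ : ℕ → (Fin d → ℕ) × Gen (Lab α π) → ℝ)
    (hmult : ∀ K, K₀ ≤ K → ∀ τ ∈ badTerms (memOf ped liveC (cellOfR n F.L (runProfile F.L R) ped cellP)) jhalf T K, ∀ c ∈ liveC K τ,
      ((koccOf ped liveC (cellOfR n F.L (runProfile F.L R) ped cellP) phys jhalf T K (kslot (keyOf ped (cellOfR n F.L (runProfile F.L R) ped cellP) phys K τ c))).card : ℝ) ≤
        Real.exp (θ * P * birthLinT Prod.fst ((ped K τ).genT c) + Ξ K ((cellOfR n F.L (runProfile F.L R) ped cellP) K τ c, (ped K τ).genT c)) *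
          Λm ^ partnerAges (PEv.step ∘ Prod.fst) ((ped K τ).genT c))
    -- H3: the per-term price sentence over the named members in PRINT's currency, discounted by the allowance; the
    -- live price of the PHYSICAL member family; both runs
    {FcM RfM FcM' RfM' : ℕ → Finset ((Fin d → ℕ) × Gen PEv × δ) → ℝ}
    (hPM : ∀ K t, |t| ≤ l₀ → K₀ ≤ K → ∀ τ ∈ badTerms (memOf ped liveC (cellOfR n F.L (runProfile F.L R) ped cellP)) jhalf T K,
      FcM K (kmemOf ped liveC (cellOfR n F.L (runProfile F.L R) ped cellP) phys K τ) * RfM K (kmemOf ped liveC (cellOfR n F.L (runProfile F.L R) ped cellP) phys K τ) ≤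
        ∏ q ∈ memOf ped liveC (cellOfR n F.L (runProfile F.L R) ped cellP) K τ,
          pshapeTH Prod.fst O C 1 Λr (R K) (D.C ⟨K, F.m, g₀ K⟩).flow.g 0 (κ K q) q.2 * Real.exp (-Ξ K q))
    (hPM' : ∀ K t, |t| ≤ l₀ → K₀ ≤ K → ∀ τ ∈ badTerms (memOf ped liveC (cellOfR n F.L (runProfile F.L R) ped cellP)) jhalf T K,
      FcM' K (kmemOf ped liveC (cellOfR n F.L (runProfile F.L R) ped cellP) phys K τ) * RfM' K (kmemOf ped liveC (cellOfR n F.L (runProfile F.L R) ped cellP) phys K τ) ≤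
        ∏ q ∈ memOf ped liveC (cellOfR n F.L (runProfile F.L R) ped cellP) K τ,
          pshapeTH Prod.fst O C 1 Λr (R K) (D.C ⟨K, F.m, g₀ K⟩).flow.g 0 (κ' K q) q.2 * Real.exp (-Ξ K q))
    -- H3: the remaining `Regeneration` numerator readings, over the PHYSICAL member families of the bad terms
    (upM : ∀ K t, |t| ≤ l₀ → K₀ ≤ K →
      ∀ k ∈ badGMems (memOf ped liveC (cellOfR n F.L (runProfile F.L R) ped cellP)) jhalf T (kmemOf ped liveC (cellOfR n F.L (runProfile F.L R) ped cellP) phys) K,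
        ∀ τ ∈ fibre (kmemOf ped liveC (cellOfR n F.L (runProfile F.L R) ped cellP) phys) T K k, A K t τ ≤ dead K t τ * FcM K k * nup K t)
    (deadM_nonneg : ∀ K t, |t| ≤ l₀ → K₀ ≤ K →
      ∀ k ∈ badGMems (memOf ped liveC (cellOfR n F.L (runProfile F.L R) ped cellP)) jhalf T (kmemOf ped liveC (cellOfR n F.L (runProfile F.L R) ped cellP) phys) K,
        ∀ τ ∈ fibre (kmemOf ped liveC (cellOfR n F.L (runProfile F.L R) ped cellP) phys) T K k, 0 ≤ dead K t τ)
    (resumM : ∀ K t, |t| ≤ l₀ → K₀ ≤ K →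
      ∀ k ∈ badGMems (memOf ped liveC (cellOfR n F.L (runProfile F.L R) ped cellP)) jhalf T (kmemOf ped liveC (cellOfR n F.L (runProfile F.L R) ped cellP) phys) K,
        ∑ τ ∈ fibre (kmemOf ped liveC (cellOfR n F.L (runProfile F.L R) ped cellP) phys) T K k, dead K t τ ≤ RfM K k)
    (FM_nonneg : ∀ K t, |t| ≤ l₀ → K₀ ≤ K →
      ∀ k ∈ badGMems (memOf ped liveC (cellOfR n F.L (runProfile F.L R) ped cellP)) jhalf T (kmemOf ped liveC (cellOfR n F.L (runProfile F.L R) ped cellP) phys) K, 0 ≤ FcM K k)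
    (upM' : ∀ K t, |t| ≤ l₀ → K₀ ≤ K →
      ∀ k ∈ badGMems (memOf ped liveC (cellOfR n F.L (runProfile F.L R) ped cellP)) jhalf T (kmemOf ped liveC (cellOfR n F.L (runProfile F.L R) ped cellP) phys) K,
        ∀ τ ∈ fibre (kmemOf ped liveC (cellOfR n F.L (runProfile F.L R) ped cellP) phys) T K k, A' K t τ ≤ dead' K t τ * FcM' K k * mup K t)
    (deadM'_nonneg : ∀ K t, |t| ≤ l₀ → K₀ ≤ K →
      ∀ k ∈ badGMems (memOf ped liveC (cellOfR n F.L (runProfile F.L R) ped cellP)) jhalf T (kmemOf ped liveC (cellOfR n F.L (runProfile F.L R) ped cellP) phys) K,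
        ∀ τ ∈ fibre (kmemOf ped liveC (cellOfR n F.L (runProfile F.L R) ped cellP) phys) T K k, 0 ≤ dead' K t τ)
    (resumM' : ∀ K t, |t| ≤ l₀ → K₀ ≤ K →
      ∀ k ∈ badGMems (memOf ped liveC (cellOfR n F.L (runProfile F.L R) ped cellP)) jhalf T (kmemOf ped liveC (cellOfR n F.L (runProfile F.L R) ped cellP) phys) K,
        ∑ τ ∈ fibre (kmemOf ped liveC (cellOfR n F.L (runProfile F.L R) ped cellP) phys) T K k, dead' K t τ ≤ RfM' K k)
    (FM'_nonneg : ∀ K t, |t| ≤ l₀ → K₀ ≤ K →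
      ∀ k ∈ badGMems (memOf ped liveC (cellOfR n F.L (runProfile F.L R) ped cellP)) jhalf T (kmemOf ped liveC (cellOfR n F.L (runProfile F.L R) ped cellP) phys) K, 0 ≤ FcM' K k)
    -- the seam's other inputs
    (hSh : ShellWeightBound l₀ T A A' shA shB Wsh)
    (hTB : ReindexedBudget l₀ vol T (fun K t τ => A K t τ - shA K t τ) (fun K t τ => A' K t τ - shB K t τ)
      (badOfClass (bstrOf Prod.fst (memOf ped liveC (cellOfR n F.L (runProfile F.L R) ped cellP))) T
        (fun K _ => badClasses Prod.fst (memOf ped liveC (cellOfR n F.L (runProfile F.L R) ped cellP)) jhalf T K)) Cc Rr CcRec RrRec ν u s₂ q₀ r s)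
    (hr : Summable r) (hu : Summable u) (hs : Summable s) (hs₂ : Summable s₂) :
    ∃ K₁ K₂, K₀ ≤ K₁ ∧ HybridNE7 l₀ vol (fun K => T (K₁ + (K₂ + K))) (fun K => A (K₁ + (K₂ + K)))
      (fun K => A' (K₁ + (K₂ + K)))
      (fun K => badOfClass (bstrOf Prod.fst (memOf ped liveC (cellOfR n F.L (runProfile F.L R) ped cellP))) T
        (fun K _ => badClasses Prod.fst (memOf ped liveC (cellOfR n F.L (runProfile F.L R) ped cellP)) jhalf T K) (K₁ + (K₂ + K)))
      (fun K => constOf l₀ B (max (em g) 0) n₁ c₀ Nup *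
        recordsBudget (birthMass C) C.κ₁ ((n : ℝ) ^ d) ((F.L : ℝ) ^ d) (Real.log 2) jhalf (K₁ + (K₂ + K)))
      (fun K => shA (K₁ + (K₂ + K))) (fun K => shB (K₁ + (K₂ + K))) (fun K => Wsh (K₁ + (K₂ + K)))
      (fun K => (r (K₁ + (K₂ + K)) + u (K₁ + (K₂ + K))) + (s (K₁ + (K₂ + K)) + s₂ (K₁ + (K₂ + K)))) :=
  hybridNE7_of_realisedRun_printedMultPPayRoot D h hμ d n hκ₁ hE₀ hb hlo hhi hγ hγβ S hp₀ hrr hβ ht hir hP1 hP hsign hcor hγB hobs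
    hbd hα hα' hc₀ hfloor hfloor' hsites hsites' hNup hnup hmup R hR hL4 hn₁ hR1 ped cellP liveC
    (cellOfR n F.L (runProfile F.L R) ped cellP)
    (realisedReadingR_of_domainsRun D hb hlo hhi hγ hγβ S hrr hβ ht R hR hn H) phys hθ hslack hΛm hΛr hΛmr κ κ' hκ hκ'
    Ξ hmult hPM hPM' upM deadM_nonneg resumM FM_nonneg upM' deadM'_nonneg resumM' FM'_nonneg hSh hTB hr hu hs hs₂

end Cells

end

end Summit.QuantumFields.BalabanUV.T4Continuum.HistoryAssemblyRealiseRunMultPPayRoot
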